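import Mathlib
import Summits.Ventures.PercRepro2.HCov
import Summits.Ventures.PercRepro2.RECMReduction
import Summits.Ventures.PercRepro2.CCWReduced
import Summits.Ventures.PercRepro2.GcSkelRules
import Summits.Ventures.PercRepro2.GcSkelReductionI
import Summits.Ventures.PercRepro2.GcBlock
import Summits.Ventures.PercRepro2.GcSkelReductionT
import Summits.Ventures.PercRepro2.OStarGlue

/-!
# The residual minus the star of `o` (blind cell PercRepro2, typer-1 g54)

mine-2 g39's `CovForm.OStar.HCov_of_star` (OStarGlue.lean, p672598): (HCOV) holds at every
admissible weight on every finite graph whose edges at `o` all lead to `a₁`, `a₂` or `b`, at most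
one to each, with no loop at `o` (`CovForm.OStar.Star ends o a₁ a₂ a₃ b e₁ e₂ eb`, the three
optional slot edges). Folded into the weighted residual as one more clause:

* **`OToMarks ends o a₁ a₂ b`** — the star class of `o` with loops ignored: every NON-LOOP edge
  at `o` is `{o, a₁}`, `{o, a₂}` or `{o, b}`; on a simple graph the slots are unique
  (`exists_star_of_oToMarks`: the loops at `o` moved to `a₁` by `relocateO`, invisible to `Gc`);
* **`HCov_of_oToMarks`** — (HCOV) on the loop-ignored star class of a simple graph;
* **`WReducedO`** := `WReducedT` ∧ ¬ `OToMarks`; **`HCov_all_iff_HCovWRedO_all`**;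
* **`exists_o_edge_off_of_wredO`** — on the residual `o` has a non-loop edge to a vertex other than
  `a₁`, `a₂`, `b` (an unmarked vertex or `a₃`).
-/

namespace Summit.Ventures.PercRepro2

open CovForm RECM

namespace WRed

/-! ## The loop-ignored star class of `o` -/

section Star

variable {V : Type*} {E : Type*}

/-- **The star class of `o`, loops ignored**: every non-loop edge at `o` goes to `a₁`, `a₂` or `b`. -/
def OToMarks (ends : E → Sym2 V) (o a₁ a₂ b : V) : Prop :=
  ∀ e, o ∈ ends e → ¬ (ends e).IsDiag → ends e = s(o, a₁) ∨ ends e = s(o, a₂) ∨ ends e = s(o, b)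

variable [DecidableEq V]

/-- The loops at `o` moved to `a₁`. -/
def relocateO (ends : E → Sym2 V) (o a₁ : V) : E → Sym2 V :=
  fun e => if (ends e).IsDiag ∧ o ∈ ends e then s(a₁, a₁) else ends e

/-- The relocated map agrees with `ends` on every non-loop edge of `ends`. -/
lemma relocateO_agree (ends : E → Sym2 V) (o a₁ : V) :
    ∀ g, ¬ (ends g).IsDiag → relocateO ends o a₁ g = ends g := by
  intro g hg
  simp [relocateO, hg]

/-- The relocated map agrees with `ends` on every non-loop edge of the relocated map. -/
lemma relocateO_agree' (ends : E → Sym2 V) (o a₁ : V) :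
    ∀ g, ¬ (relocateO ends o a₁ g).IsDiag → relocateO ends o a₁ g = ends g := by
  intro g hg
  by_cases h : (ends g).IsDiag ∧ o ∈ ends g
  · exfalso
    apply hg
    simp [relocateO, h]
  · simp [relocateO, h]

/-- No loop of the relocated map sits at `o ≠ a₁`. -/
lemma not_loop_at_o_relocateO {ends : E → Sym2 V} {o a₁ : V} (ho1 : o ≠ a₁) {g : E}
    (hg : o ∈ relocateO ends o a₁ g) : ¬ (relocateO ends o a₁ g).IsDiag := by
  intro hd
  by_cases h : (ends g).IsDiag ∧ o ∈ ends g
  · simp only [relocateO, h, and_self, if_true, Sym2.mem_iff, or_self] at hg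
    exact ho1 hg
  · simp only [relocateO, h, if_false] at hg hd
    exact h ⟨hd, hg⟩

open Classical in
/-- **The slots from simplicity**: on a simple graph in the loop-ignored star class, the relocated
map is a `Star` with the (at most one) edge to each of `a₁`, `a₂`, `b` as its slots. -/
theorem exists_star_of_oToMarks {ends : E → Sym2 V} (hsimp : Simple ends) {o a₁ a₂ a₃ b : V}
    (h : OToMarks ends o a₁ a₂ b) (ho1 : o ≠ a₁) (ho2 : o ≠ a₂) (ho3 : o ≠ a₃) (hob : o ≠ b)
    (h12 : a₁ ≠ a₂) (hb1 : b ≠ a₁) (hb2 : b ≠ a₂) :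
    ∃ e₁ e₂ eb : Option E, CovForm.OStar.Star (relocateO ends o a₁) o a₁ a₂ a₃ b e₁ e₂ eb := by
  -- the slot of a target `x ≠ o`: the edge `{o, x}` if there is one
  let slot : V → Option E := fun x =>
    if hx : ∃ e, ends e = s(o, x) then some (Classical.choose hx) else none
  have hslot : ∀ x, x ≠ o → ∀ e, slot x = some e → relocateO ends o a₁ e = s(o, x) := by
    intro x hxo e he
    simp only [slot] at he
    split_ifs at he with hx
    · have hc := Classical.choose_spec hx
      rw [Option.some_inj] at he
      subst he
      rw [relocateO_agree ends o a₁ _ (by rw [hc, Sym2.mk_isDiag_iff]; exact fun h => hxo h.symm)]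
      exact hc
  have hall : ∀ e, o ∈ relocateO ends o a₁ e →
      slot a₁ = some e ∨ slot a₂ = some e ∨ slot b = some e := by
    intro e he
    have hnd := not_loop_at_o_relocateO ho1 he
    rw [relocateO_agree' ends o a₁ e hnd] at he hnd
    -- `e` is a non-loop edge at `o`: one of the three targets, and the unique such edge
    have key : ∀ x, x ≠ o → ends e = s(o, x) → slot x = some e := by
      intro x hxo hex
      have hx : ∃ e', ends e' = s(o, x) := ⟨e, hex⟩
      simp only [slot, dif_pos hx]
      congr 1
      by_contra hne
      exact hsimp _ _ (Ne.symm hne) (by rw [hex, Sym2.mk_isDiag_iff]; exact fun h => hxo h.symm)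
        (by rw [hex, Classical.choose_spec hx])
    rcases h e he hnd with h1 | h2 | hb
    · exact Or.inl (key a₁ ho1.symm h1)
    · exact Or.inr (Or.inl (key a₂ ho2.symm h2))
    · exact Or.inr (Or.inr (key b hob.symm hb))
  exact ⟨slot a₁, slot a₂, slot b, ⟨hslot a₁ ho1.symm, hslot a₂ ho2.symm, hslot b hob.symm, hall,
    ho1, ho2, ho3, hob, h12, hb1.symm, hb2.symm⟩⟩


/-- **(HCOV) on the loop-ignored star class of a simple graph**: the loops at `o` are moved to
`a₁` (invisible to `Gc`), and mine-2 g39's `HCov_of_star` applies to the relocated map. -/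
theorem HCov_of_oToMarks {R : Type*} [Field R] [LinearOrder R] [IsStrictOrderedRing R]
    [Fintype E] [DecidableEq E] {ends : E → Sym2 V} (hsimp : Simple ends) {o a₁ a₂ a₃ b : V}
    (h : OToMarks ends o a₁ a₂ b) (ho1 : o ≠ a₁) (ho2 : o ≠ a₂) (ho3 : o ≠ a₃) (hob : o ≠ b)
    (h12 : a₁ ≠ a₂) (hb1 : b ≠ a₁) (hb2 : b ≠ a₂) (p : E → R) (hp : IsProbVec p) :
    HCov p ends o a₁ a₂ a₃ b := by
  classical
  obtain ⟨e₁, e₂, eb, hS⟩ := exists_star_of_oToMarks hsimp h ho1 ho2 ho3 hob h12 hb1 hb2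
  unfold HCov
  rw [Gc_eq_of_agree_nonLoop p (relocateO_agree ends o a₁) (relocateO_agree' ends o a₁)]
  exact CovForm.OStar.HCov_of_star hS p hp

end Star

/-! ## The residual minus the star of `o` -/

section ClassO

variable {V : Type*} {E : Type*} [Fintype E] [DecidableEq E] [DecidableEq V]

/-- **The residual minus the star of `o`**: `WReducedT`, and `o` has a non-loop edge to a vertex
other than `a₁`, `a₂`, `b`. -/
structure WReducedO (ends : E → Sym2 V) (o a₁ a₂ a₃ b : V) : Prop
    extends WReducedT ends o a₁ a₂ a₃ b where
  /-- not the star class of `o` -/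
  notOStar : ¬ OToMarks ends o a₁ a₂ b

omit [DecidableEq E] in
/-- **On the residual `o` has a non-loop edge to a vertex other than `a₁`, `a₂`, `b`.** -/
theorem exists_o_edge_off_of_wredO {ends : E → Sym2 V} {o a₁ a₂ a₃ b : V}
    (h : WReducedO ends o a₁ a₂ a₃ b) :
    ∃ (e : E) (x : V), ends e = s(o, x) ∧ x ≠ o ∧ x ≠ a₁ ∧ x ≠ a₂ ∧ x ≠ b := by
  by_contra hc
  push Not at hc
  apply h.notOStar
  intro e he hd
  obtain ⟨x, hx⟩ := Sym2.mem_iff_exists.mp he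
  have hxo : x ≠ o := by
    intro hxo
    rw [hx, hxo, Sym2.mk_isDiag_iff] at hd
    exact hd rfl
  by_cases h1 : x = a₁
  · exact Or.inl (by rw [hx, h1])
  by_cases h2 : x = a₂
  · exact Or.inr (Or.inl (by rw [hx, h2]))
  by_cases hb : x = b
  · exact Or.inr (Or.inr (by rw [hx, hb]))
  exact absurd (hc e x hx hxo h1 h2) hb

end ClassO

section Closure

variable (R : Type*) [Field R] [LinearOrder R] [IsStrictOrderedRing R]

/-- **(HCOV) on the residual minus the star of `o`**. -/
def HCovWRedO_all : Prop :=
  ∀ (V E : Type) [Fintype V] [DecidableEq V] [Fintype E] [DecidableEq E]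
    (ends : E → Sym2 V) (p : E → R), IsProbVec p →
    ∀ o a₁ a₂ a₃ b : V, a₁ ≠ a₂ → a₁ ≠ a₃ → a₂ ≠ a₃ → o ≠ a₁ → o ≠ a₂ → o ≠ a₃ → o ≠ b →
      b ≠ a₁ → b ≠ a₂ → b ≠ a₃ → WReducedO ends o a₁ a₂ a₃ b → HCov p ends o a₁ a₂ a₃ b

end Closure

section Main

variable {R : Type*} [Field R] [LinearOrder R] [IsStrictOrderedRing R]

/-- The star class of `o` is a theorem on the residual: no induction. -/
theorem HCovWRedT_all_of_HCovWRedO_all (hB : HCovWRedO_all R) : HCovWRedT_all R := by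
  intro V E _ _ _ _ ends p hp o a₁ a₂ a₃ b h12 h13 h23 ho1 ho2 ho3 hob hb1 hb2 hb3 hred
  by_cases hS : OToMarks ends o a₁ a₂ b
  · exact HCov_of_oToMarks hred.simple hS ho1 ho2 ho3 hob h12 hb1 hb2 p hp
  · exact hB V E ends p hp o a₁ a₂ a₃ b h12 h13 h23 ho1 ho2 ho3 hob hb1 hb2 hb3 ⟨hred, hS⟩

/-- **THE WEIGHTED RESIDUAL MINUS THE STAR OF `o`**: (HCOV) for every finite weighted graph with
five distinct marks follows from (HCOV) on `WReducedO`. -/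
theorem HCov_all_of_HCovWRedO_all (hB : HCovWRedO_all R) : HCov_all R :=
  HCov_all_of_HCovWRedT_all (HCovWRedT_all_of_HCovWRedO_all hB)

/-- The residual minus the star of `o` is a faithful reduction. -/
theorem HCov_all_iff_HCovWRedO_all : HCov_all R ↔ HCovWRedO_all R :=
  ⟨fun h V E _ _ _ _ ends p hp o a₁ a₂ a₃ b h12 h13 h23 ho1 ho2 ho3 hob hb1 hb2 hb3 _ =>
    h V E ends p hp o a₁ a₂ a₃ b h12 h13 h23 ho1 ho2 ho3 hob hb1 hb2 hb3,
   HCov_all_of_HCovWRedO_all⟩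

/-- The two residuals are equivalent closures. -/
theorem HCovWRedT_all_iff_HCovWRedO_all : HCovWRedT_all R ↔ HCovWRedO_all R := by
  rw [← HCov_all_iff_HCovWRedT_all, ← HCov_all_iff_HCovWRedO_all]

end Main

end WRed

end Summit.Ventures.PercRepro2
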